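import Summits.QuantumFields.BalabanUV.Gaps.D1CoDressedLongitudinalForm

/-!
# `BalabanUV.Gaps.D1ReflectionSecondMoments` — cell pub-balaban-gaps, row (D1), seat g1-p1: THE SECOND-MOMENT TENSOR `Σ_z P_{μν}(z) z_α z_γ` UNDER (5.7)–(5.9), AND (5.16) TO SECOND ORDER
# CHANNEL BY CHANNEL — the reflection covariance (5.7)–(5.8) ALONE kills every component off the pairing pattern (`μ = ν ≠ α = γ` or `μ ≠ ν`, `{α,γ} = {μ,ν}`); with (5.9) the survivors are
# `−2β_{αμ}` and `β_{μν}`; hence for every real test vector `v` and direction `k` the quadratic germ `−½ Σ_z (Σ_{μν} v_μ v_ν P_{μν}(z))(k·z)²` of the symbol form IS THE β-WEIGHTED PLÜCKER FORM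
# `½ Σ_{μ≠ν} β_{μν} (v_μ k_ν − v_ν k_μ)²`, nonnegative for all `(v,k)` IFF all six `β_{ab} ≥ 0`

HONEST FRAMING (cell rule, page 1 of everything): [folklore] lattice bookkeeping — re-indexing of lattice sums by the reflection bijections of an2's `OddMoments` (no summability), Fubini for
finite × absolutely convergent sums (`MomentSummable P 3`, an2's `summable_mul_coord_mul_coord`), composed BY NAME with row 86's hR-free (1.22) (`secondMoment_eq_neg_half_of_ward_indexSymmetric`),
leaf-01's `sqMoment_self_eq_zero_of_ward`, (5.8)'s `secondMoment_comm`.  (5.16) p. 293 [Balaban1987RG1] *"Π_{μν}(p) = β(δ_{μν}Δ(p) − ∂̄_μ(p)∂_ν(p)) + …"* is PRINTED for Bałaban's Π and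
NOT used; what is proved is its second-order content for ANY kernel with the typed predicates (5.7) `AxisReflectionCovariant`, (5.8) `IndexSymmetric`, (5.9) `WardTransversal` and summable third
moments — with the single printed `β` replaced by the MATRIX of (1.22) coefficients `β_{μν}` (the rotation symmetry (1.21), which would equate them, is NOT assumed; it fails by value for the
record literal at level 0, RESULT-5).  NOTHING of Bałaban's is asserted; no symbol is computed or certified; hR ∕ hW at the pinned ∕ (III′) literals REMAIN hypotheses (theorems only at an2's
chart-(II) literal); NO coefficient of Bałaban's computed or signed; (D1) NOT discharged; 0∕4 row-D1 binders at the pinned ∕ (III′) literals; NOT `BetaPertH`, NOT continuum, NOT Clay.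
HONEST DEPENDENCY (b2b cell, verbatim): «continuum YM on T⁴ ⇐ BetaPertH ∧ nine spine estimates (0/9 proved); BetaPertH ⇐ (D1) ∧ (D4) ∧ CAP+tail; G-an2-4 gates asym, D1 and NE2/3/4.»

WHY (census row 98 of `HOME/g1/RESIDUE.md`).  Rows 94–97 located the whole by-value content of the PSD binder at `k → 0` and computed the germ there entry by entry (row 95), for the trace
(row 97) and, for a general real vector and direction, as the CONTRACTED SECOND-MOMENT TENSOR (row 97, no closed form).  Under the END's second symmetry binder hR (5.7) — a THEOREM at
an2's `JsRowD1Pin` — the tensor closes: §1 computes all its components, §2 contracts it, and the germ becomes `Σ_{μ≠ν} β_{μν}(v_ν²k_μ² − v_μv_νk_μk_ν) = ½ Σ_{μ≠ν} β_{μν}(v_μk_ν − v_νk_μ)²`.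
Consequence (§3): TO SECOND ORDER AT ZERO MOMENTUM, POSITIVITY OF THE POLARIZATION SYMBOL ON REAL VECTORS IS EXACTLY `∀ a ≠ b, 0 ≤ β_{ab}` — the β sub-cell's Lemma 5.2 («PSD ⟹ β ≥ 0»)
is, at the germ, an EQUIVALENCE, channel by channel; a by-value PSD screen near `k = 0` tests nothing but the six signs.  The limit statements (the germ as `lim_{p→0} (…)∕p²`) and the
literal corollaries are in the companion `Gaps/D1SymbolPlueckerGerm` (row 99).
WHAT IT IS NOT: no certificate; hR ∕ hW (pinned ∕ (III′)), the VALUE side of (D1), (1.21), `D1Tel` ∕ `D1Rep` untouched; the words of the row do not move.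

CONTENT (all [folklore]; no `def`, no `def … : Prop`, 0 sorry): §1 `diag_axisReflect` (diagonal channels are even under every axis reflection), **`sqMoment_diag_mixed_eq_zero`** (`μ = ν`, `α ≠ γ`),
**`sqMoment_offDiag_free_eq_zero`** (`μ ≠ ν`, a free axis appearing once), **`sqMoment_offDiag_sq_eq_zero`** (`μ ≠ ν`, every square weight `z_δ²`), **`sqMomentTensor_eq`** (all components under
(5.7)–(5.9) + moments); §2 **`contract_row`**, `tsum_form_sq_phase_eq` (Fubini), **`germ_closedForm`** (`−½ Σ_z (Σ v_μv_νP_{μν}(z))(k·z)² = Σ_μΣ_α[α≠μ] β_{αμ}v_μ²k_α² − Σ_μΣ_ν[μ≠ν] β_{μν}v_μv_νk_μk_ν`),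
**`germ_eq_pluecker`** (`= ½ Σ_μΣ_ν [μ≠ν] β_{μν}(v_μk_ν − v_νk_μ)²`); §3 `form_basis`, `phase_basis`, `germ_basis` (at `(e_b, e_a)` the germ is `β_{ab}`), **`germ_nonneg_iff`**.

Provenance: cell pub-balaban-gaps, seat g1-p1 GEN 19 (prover-pub-balaban-gaps-g1-p1-g19-0), 2026-08-26 (INTENT-75); imports this seat's row 87 `Gaps/D1CoDressedLongitudinalForm` (p402229 ✓; through
it row 86, an2's `OddMoments` ∕ `PolarizationSign`, leaf-01's `WardDiagonalSecondMoment`) — all BUILT; no existing file touched.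
-/

noncomputable section

open Finset Filter Topology
open scoped BigOperators Real

namespace Summit.QuantumFields.BalabanUV.Gaps.D1ReflectionSecondMoments

open Literature.MathematicalPhysics.QuantumFieldTheory.Balaban1983to89
open Literature.MathematicalPhysics.QuantumFieldTheory.Balaban1983to89.Beta.PolarizationSign (WardTransversal IndexSymmetric AxisReflectionCovariant MomentSummable
  axisReflect axisReflect_apply axisReflect_axisReflect reflSign secondMoment_comm tsum_eq_zero_of_ward)
open Literature.MathematicalPhysics.QuantumFieldTheory.Balaban1983to89.B6BondElimination (unitVec unitVec_apply)
open Literature.MathematicalPhysics.QuantumFieldTheory.Balaban1983to89.Beta.OddMoments (summable_mul_coord_mul_coord)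
open Summit.QuantumFields.BalabanUV.Beta.D1BFx.WardDiagonalSecondMoment (sqMoment_self_eq_zero_of_ward)
open Summit.QuantumFields.BalabanUV.Gaps.D1WardLongitudinalForm (secondMoment_eq_neg_half_of_ward_indexSymmetric)

attribute [local simp] Literature.MathematicalPhysics.QuantumFieldTheory.Balaban1983to89.B6BondElimination.unitVec_apply

variable {d : ℕ}

/-! ## §1 Under the reflection covariance (5.7)–(5.8) ALONE the second-moment tensor `Σ_z P_{μν}(z) z_α z_γ` vanishes off the pairing pattern (no Ward identity, no summability) -/

/-- [folklore] DIAGONAL channels are EVEN under every axis reflection ((5.7) with `μ = ν`: the two half-shifts cancel): `P_{μμ}(εz) = P_{μμ}(z)`. -/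
theorem diag_axisReflect {P : B12Beta.Kernel d} (hR : AxisReflectionCovariant P) (δ μ : Fin d) (z : Fin d → ℤ) : P μ μ (axisReflect δ z) = P μ μ z := by
  have h0 := hR δ μ μ z
  by_cases hμ : μ = δ
  · subst hμ; simp [reflSign] at h0; exact h0
  · simp [reflSign, hμ] at h0; exact h0

/-- [folklore] **DIAGONAL CHANNEL, MIXED WEIGHT**: `Σ_z P_{μμ}(z) z_α z_γ = 0` for `α ≠ γ` (reflect the axis `α`: the kernel is even, the weight odd). -/
theorem sqMoment_diag_mixed_eq_zero {P : B12Beta.Kernel d} (hR : AxisReflectionCovariant P) (μ : Fin d) {α γ : Fin d} (hαγ : α ≠ γ) :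
    ∑' z, P μ μ z * ((z α : ℝ) * (z γ : ℝ)) = 0 := by
  let φ : (Fin d → ℤ) ≃ (Fin d → ℤ) :=
    { toFun := axisReflect α, invFun := axisReflect α, left_inv := axisReflect_axisReflect α, right_inv := axisReflect_axisReflect α }
  have hP : ∀ z, P μ μ (φ z) = P μ μ z := fun z => diag_axisReflect hR α μ z
  have hw : ∀ z, (((φ z) α : ℤ) : ℝ) * (((φ z) γ : ℤ) : ℝ) = -((z α : ℝ) * (z γ : ℝ)) := by
    intro z
    show ((axisReflect α z α : ℤ) : ℝ) * ((axisReflect α z γ : ℤ) : ℝ) = -((z α : ℝ) * (z γ : ℝ))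
    simp [hαγ.symm]
  have hsum := φ.tsum_eq (fun w => P μ μ w * ((w α : ℝ) * (w γ : ℝ)))
  simp only [hP, hw] at hsum
  have h' : ∑' z, P μ μ z * -((z α : ℝ) * (z γ : ℝ)) = -∑' z, P μ μ z * ((z α : ℝ) * (z γ : ℝ)) := by
    rw [← tsum_neg]; exact tsum_congr fun z => by ring
  linarith

/-- [folklore] **OFF-DIAGONAL CHANNEL (`μ ≠ ν`), A FREE AXIS**: if `δ ∉ {μ, ν}` and `γ ≠ δ` then `Σ_z P_{μν}(z) z_δ z_γ = 0` (reflect the axis `δ`: no shift, the weight is odd). -/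
theorem sqMoment_offDiag_free_eq_zero {P : B12Beta.Kernel d} (hR : AxisReflectionCovariant P) {μ ν δ γ : Fin d} (hδμ : δ ≠ μ) (hδν : δ ≠ ν) (hγδ : γ ≠ δ) :
    ∑' z, P μ ν z * ((z δ : ℝ) * (z γ : ℝ)) = 0 := by
  let φ : (Fin d → ℤ) ≃ (Fin d → ℤ) :=
    { toFun := axisReflect δ, invFun := axisReflect δ, left_inv := axisReflect_axisReflect δ, right_inv := axisReflect_axisReflect δ }
  have hP : ∀ z, P μ ν (φ z) = P μ ν z := by
    intro z
    have h0 := hR δ μ ν z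
    simp [reflSign, hδμ.symm, hδν.symm] at h0
    exact h0
  have hw : ∀ z, (((φ z) δ : ℤ) : ℝ) * (((φ z) γ : ℤ) : ℝ) = -((z δ : ℝ) * (z γ : ℝ)) := by
    intro z
    show ((axisReflect δ z δ : ℤ) : ℝ) * ((axisReflect δ z γ : ℤ) : ℝ) = -((z δ : ℝ) * (z γ : ℝ))
    simp [hγδ]
  have hsum := φ.tsum_eq (fun w => P μ ν w * ((w δ : ℝ) * (w γ : ℝ)))
  simp only [hP, hw] at hsum
  have h' : ∑' z, P μ ν z * -((z δ : ℝ) * (z γ : ℝ)) = -∑' z, P μ ν z * ((z δ : ℝ) * (z γ : ℝ)) := by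
    rw [← tsum_neg]; exact tsum_congr fun z => by ring
  linarith

/-- [folklore] **OFF-DIAGONAL CHANNEL (`μ ≠ ν`), A SQUARE WEIGHT**: `Σ_z P_{μν}(z) z_δ² = 0` for EVERY `δ` (for `δ ≠ μ` reflect the left index's axis, `P_{μν}(εz − e_μ) = −P_{μν}(z)`, the
weight is invariant; for `δ = μ` reflect the right index's axis, `P_{μν}(εz + e_ν) = −P_{μν}(z)`). -/
theorem sqMoment_offDiag_sq_eq_zero {P : B12Beta.Kernel d} (hR : AxisReflectionCovariant P) {μ ν : Fin d} (hμν : μ ≠ ν) (δ : Fin d) :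
    ∑' z, P μ ν z * ((z δ : ℝ) * (z δ : ℝ)) = 0 := by
  by_cases hδ : δ = μ
  · subst hδ
    -- reflect the axis of the RIGHT index
    let φ : (Fin d → ℤ) ≃ (Fin d → ℤ) :=
      { toFun := fun z => axisReflect ν z + unitVec ν
        invFun := fun w => axisReflect ν (w - unitVec ν)
        left_inv := fun z => by simp only [add_sub_cancel_right, axisReflect_axisReflect]
        right_inv := fun w => by simp only [axisReflect_axisReflect, sub_add_cancel] }
    have hP : ∀ z, P δ ν (φ z) = -P δ ν z := by
      intro z
      have h0 := hR ν δ ν z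
      simp [reflSign, hμν] at h0
      have e : φ z = axisReflect ν z + unitVec ν := rfl
      rw [e]; linarith
    have hw : ∀ z, (((φ z) δ : ℤ) : ℝ) = (z δ : ℝ) := by
      intro z
      have e : φ z = axisReflect ν z + unitVec ν := rfl
      rw [e]; simp [hμν]
    have hsum := φ.tsum_eq (fun w => P δ ν w * ((w δ : ℝ) * (w δ : ℝ)))
    simp only [hP, hw] at hsum
    have h' : ∑' z, -P δ ν z * ((z δ : ℝ) * (z δ : ℝ)) = -∑' z, P δ ν z * ((z δ : ℝ) * (z δ : ℝ)) := by
      rw [← tsum_neg]; exact tsum_congr fun z => by ring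
    linarith
  · -- reflect the axis of the LEFT index
    let φ : (Fin d → ℤ) ≃ (Fin d → ℤ) :=
      { toFun := fun z => axisReflect μ z - unitVec μ
        invFun := fun w => axisReflect μ (w + unitVec μ)
        left_inv := fun z => by simp only [sub_add_cancel, axisReflect_axisReflect]
        right_inv := fun w => by simp only [axisReflect_axisReflect, add_sub_cancel_right] }
    have hP : ∀ z, P μ ν (φ z) = -P μ ν z := by
      intro z
      have h0 := hR μ μ ν z
      simp [reflSign, hμν.symm] at h0
      have e : φ z = axisReflect μ z - unitVec μ := rfl
      rw [e]; linarith
    have hw : ∀ z, (((φ z) δ : ℤ) : ℝ) = (z δ : ℝ) := by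
      intro z
      have e : φ z = axisReflect μ z - unitVec μ := rfl
      rw [e]; simp [hδ]
    have hsum := φ.tsum_eq (fun w => P μ ν w * ((w δ : ℝ) * (w δ : ℝ)))
    simp only [hP, hw] at hsum
    have h' : ∑' z, -P μ ν z * ((z δ : ℝ) * (z δ : ℝ)) = -∑' z, P μ ν z * ((z δ : ℝ) * (z δ : ℝ)) := by
      rw [← tsum_neg]; exact tsum_congr fun z => by ring
    linarith

/-- [folklore] **THE SECOND-MOMENT TENSOR UNDER (5.7)–(5.9) + summable third moments, ALL COMPONENTS**: `Σ_z P_{μν}(z) z_α z_γ` equals `−2β_{αμ}` if `μ = ν ≠ α = γ`, `β_{μν}` if `μ ≠ ν` and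
`{α, γ} = {μ, ν}`, and `0` otherwise (`β_{ab} = B12Beta.secondMoment P a b`; the diagonal-square entry `μ = ν = α = γ` vanishes by (5.9), leaf-01's `sqMoment_self_eq_zero_of_ward`; `−2β_{αμ}` is
row 86's hR-free (1.22)). -/
theorem sqMomentTensor_eq {P : B12Beta.Kernel d} (hP : MomentSummable P 3) (hT : WardTransversal P) (hS : IndexSymmetric P) (hR : AxisReflectionCovariant P) (μ ν α γ : Fin d) :
    ∑' z, P μ ν z * ((z α : ℝ) * (z γ : ℝ))
      = if μ = ν then (if α = γ then (if α = μ then 0 else -2 * B12Beta.secondMoment P α μ) else 0)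
        else (if (α = μ ∧ γ = ν) ∨ (α = ν ∧ γ = μ) then B12Beta.secondMoment P μ ν else 0) := by
  by_cases hμν : μ = ν
  · subst hμν
    rw [if_pos rfl]
    by_cases hαγ : α = γ
    · subst hαγ
      rw [if_pos rfl]
      by_cases hαμ : α = μ
      · subst hαμ; rw [if_pos rfl]
        simpa only [pow_two] using sqMoment_self_eq_zero_of_ward hP hT α α
      · rw [if_neg hαμ, secondMoment_eq_neg_half_of_ward_indexSymmetric hP hT hS hαμ]
        have e : ∑' z, P μ μ z * ((z α : ℝ) * (z α : ℝ)) = ∑' z, P μ μ z * (z α : ℝ) ^ 2 := tsum_congr fun z => by ring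
        rw [e]; ring
    · rw [if_neg hαγ]; exact sqMoment_diag_mixed_eq_zero hR μ hαγ
  · rw [if_neg hμν]
    by_cases hpair : (α = μ ∧ γ = ν) ∨ (α = ν ∧ γ = μ)
    · rw [if_pos hpair]
      rcases hpair with ⟨rfl, rfl⟩ | ⟨rfl, rfl⟩
      · unfold B12Beta.secondMoment; exact tsum_congr fun z => by ring
      · unfold B12Beta.secondMoment; exact tsum_congr fun z => by ring
    · rw [if_neg hpair]
      push Not at hpair
      -- case analysis on the weight indices
      by_cases hαγ : α = γ
      · subst hαγ; exact sqMoment_offDiag_sq_eq_zero hR hμν α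
      · by_cases hα : α = μ ∨ α = ν
        · -- then γ must be the free axis (else the pair pattern), reflect γ
          have hγμ : γ ≠ μ := by
            rintro rfl
            rcases hα with rfl | rfl
            · exact hαγ rfl
            · exact hpair.2 rfl rfl
          have hγν : γ ≠ ν := by
            rintro rfl
            rcases hα with rfl | rfl
            · exact hpair.1 rfl rfl
            · exact hαγ rfl
          have h := sqMoment_offDiag_free_eq_zero hR hγμ hγν hαγ
          simpa only [mul_comm] using h
        · push Not at hα
          exact sqMoment_offDiag_free_eq_zero hR hα.1 hα.2 (Ne.symm hαγ)


/-! ## §2 The contraction with `k ⊗ k`, channel by channel, and the quadratic germ in closed form -/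

/-- [folklore] **ROW-WISE CONTRACTION**: under (5.7)–(5.9) + summable third moments, for every `μ, ν` and direction `k`,
`Σ_α Σ_γ k_α k_γ Σ_z P_{μν}(z) z_α z_γ = [μ = ν]·Σ_α [α ≠ μ] (−2β_{αμ}) k_α² + [μ ≠ ν]·2 k_μ k_ν β_{μν}`. -/
theorem contract_row {P : B12Beta.Kernel d} (hP : MomentSummable P 3) (hT : WardTransversal P) (hS : IndexSymmetric P) (hR : AxisReflectionCovariant P) (k : Fin d → ℝ) (μ ν : Fin d) :
    ∑ α, ∑ γ, k α * k γ * ∑' z, P μ ν z * ((z α : ℝ) * (z γ : ℝ))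
      = if μ = ν then ∑ α, (if α = μ then 0 else -2 * B12Beta.secondMoment P α μ * k α ^ 2) else 2 * k μ * k ν * B12Beta.secondMoment P μ ν := by
  by_cases hμν : μ = ν
  · subst hμν
    rw [if_pos rfl]
    refine Finset.sum_congr rfl fun α _ => ?_
    rw [Finset.sum_eq_single α (fun γ _ hγ => by rw [sqMoment_diag_mixed_eq_zero hR μ (Ne.symm hγ), mul_zero]) (fun h => absurd (Finset.mem_univ α) h)]
    by_cases hα : α = μ
    · subst hα
      rw [if_pos rfl]
      have h0 : ∑' z, P α α z * ((z α : ℝ) * (z α : ℝ)) = 0 := by simpa only [pow_two] using sqMoment_self_eq_zero_of_ward hP hT α α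
      rw [h0, mul_zero]
    · rw [if_neg hα, secondMoment_eq_neg_half_of_ward_indexSymmetric hP hT hS hα]
      have e : ∑' z, P μ μ z * ((z α : ℝ) * (z α : ℝ)) = ∑' z, P μ μ z * (z α : ℝ) ^ 2 := tsum_congr fun z => by ring
      rw [e]; ring
  · rw [if_neg hμν]
    have hpair : ∑' z, P μ ν z * ((z μ : ℝ) * (z ν : ℝ)) = B12Beta.secondMoment P μ ν := by
      unfold B12Beta.secondMoment; exact tsum_congr fun z => by ring
    have hpair' : ∑' z, P μ ν z * ((z ν : ℝ) * (z μ : ℝ)) = B12Beta.secondMoment P μ ν := by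
      unfold B12Beta.secondMoment; exact tsum_congr fun z => by ring
    have hrow : ∀ α, ∑ γ, k α * k γ * ∑' z, P μ ν z * ((z α : ℝ) * (z γ : ℝ))
        = (if α = μ then k μ * k ν * B12Beta.secondMoment P μ ν else 0) + (if α = ν then k ν * k μ * B12Beta.secondMoment P μ ν else 0) := by
      intro α
      by_cases h1 : α = μ
      · subst h1
        rw [if_pos rfl, if_neg hμν, add_zero, Finset.sum_eq_single ν (fun γ _ hγ => ?_) (fun h => absurd (Finset.mem_univ ν) h), hpair]
        by_cases h2 : γ = α
        · subst h2; rw [sqMoment_offDiag_sq_eq_zero hR hμν, mul_zero]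
        · have h := sqMoment_offDiag_free_eq_zero hR h2 hγ (Ne.symm h2)
          rw [show (fun z => P α ν z * ((z α : ℝ) * (z γ : ℝ))) = fun z => P α ν z * ((z γ : ℝ) * (z α : ℝ)) from funext fun z => by ring, h, mul_zero]
      · by_cases h3 : α = ν
        · subst h3
          rw [if_neg h1, zero_add, if_pos rfl, Finset.sum_eq_single μ (fun γ _ hγ => ?_) (fun h => absurd (Finset.mem_univ μ) h), hpair']
          by_cases h2 : γ = α
          · subst h2; rw [sqMoment_offDiag_sq_eq_zero hR hμν, mul_zero]
          · have h := sqMoment_offDiag_free_eq_zero hR hγ h2 (Ne.symm h2)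
            rw [show (fun z => P μ α z * ((z α : ℝ) * (z γ : ℝ))) = fun z => P μ α z * ((z γ : ℝ) * (z α : ℝ)) from funext fun z => by ring, h, mul_zero]
        · rw [if_neg h1, if_neg h3, add_zero]
          exact Finset.sum_eq_zero fun γ _ => by
            by_cases h2 : γ = α
            · subst h2; rw [sqMoment_offDiag_sq_eq_zero hR hμν, mul_zero]
            · rw [sqMoment_offDiag_free_eq_zero hR h1 h3 h2, mul_zero]
    rw [Finset.sum_congr rfl fun α _ => hrow α, Finset.sum_add_distrib, Finset.sum_ite_eq' Finset.univ μ, Finset.sum_ite_eq' Finset.univ ν]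
    simp only [Finset.mem_univ, if_true]
    ring

/-- [folklore] Fubini for the contraction: `Σ_z (Σ_{μν} v_μ v_ν P_{μν}(z)) (k·z)² = Σ_{μν} v_μ v_ν Σ_{αγ} k_α k_γ Σ_z P_{μν}(z) z_α z_γ` (summable third moments). -/
theorem tsum_form_sq_phase_eq {P : B12Beta.Kernel d} (hP : MomentSummable P 3) (v k : Fin d → ℝ) :
    ∑' z, (∑ μ, ∑ ν, v μ * v ν * P μ ν z) * (∑ i, k i * z i) ^ 2 = ∑ μ, ∑ ν, v μ * v ν * ∑ α, ∑ γ, k α * k γ * ∑' z, P μ ν z * ((z α : ℝ) * (z γ : ℝ)) := by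
  have hs : ∀ μ ν α γ, Summable fun z => v μ * v ν * (k α * k γ * (P μ ν z * ((z α : ℝ) * (z γ : ℝ)))) := fun μ ν α γ =>
    ((summable_mul_coord_mul_coord hP μ ν α γ).mul_left _).mul_left _
  have hpt : ∀ z : Fin d → ℤ, (∑ μ, ∑ ν, v μ * v ν * P μ ν z) * (∑ i, k i * z i) ^ 2 = ∑ μ, ∑ ν, ∑ α, ∑ γ, v μ * v ν * (k α * k γ * (P μ ν z * ((z α : ℝ) * (z γ : ℝ)))) := by
    intro z
    rw [sq, Finset.sum_mul]; refine Finset.sum_congr rfl fun μ _ => ?_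
    rw [Finset.sum_mul]; refine Finset.sum_congr rfl fun ν _ => ?_
    rw [Finset.sum_mul_sum, Finset.mul_sum]; refine Finset.sum_congr rfl fun α _ => ?_
    rw [Finset.mul_sum]; exact Finset.sum_congr rfl fun γ _ => by ring
  simp_rw [hpt]
  rw [Summable.tsum_finsetSum fun μ _ => summable_sum fun ν _ => summable_sum fun α _ => summable_sum fun γ _ => hs μ ν α γ]
  refine Finset.sum_congr rfl fun μ _ => ?_
  rw [Summable.tsum_finsetSum fun ν _ => summable_sum fun α _ => summable_sum fun γ _ => hs μ ν α γ]
  refine Finset.sum_congr rfl fun ν _ => ?_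
  rw [Summable.tsum_finsetSum fun α _ => summable_sum fun γ _ => hs μ ν α γ, Finset.mul_sum]
  refine Finset.sum_congr rfl fun α _ => ?_
  rw [Summable.tsum_finsetSum fun γ _ => hs μ ν α γ, Finset.mul_sum]
  refine Finset.sum_congr rfl fun γ _ => ?_
  rw [tsum_mul_left, tsum_mul_left]

/-- [folklore] **THE QUADRATIC GERM OF THE POLARIZATION SYMBOL IN CLOSED FORM — (5.16) CHANNEL BY CHANNEL**: under (5.7)–(5.9) + summable third moments, for every real test vector `v`
and direction `k`, `−½ Σ_z (Σ_{μν} v_μ v_ν P_{μν}(z)) (k·z)² = Σ_μ Σ_α [α ≠ μ] β_{αμ} v_μ² k_α² − Σ_μ Σ_ν [μ ≠ ν] β_{μν} v_μ v_ν k_μ k_ν` — the printed second-order shape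
`β(δ_{μν}Δ(p) − ∂̄_μ∂_ν)` with the single `β` replaced by the MATRIX of (1.22) coefficients `β_{μν} = Σ_x P_{μν}(x) x_μ x_ν` (no rotation symmetry (1.21) used). -/
theorem germ_closedForm {P : B12Beta.Kernel d} (hP : MomentSummable P 3) (hT : WardTransversal P) (hS : IndexSymmetric P) (hR : AxisReflectionCovariant P) (v k : Fin d → ℝ) :
    -(1 / 2) * ∑' z, (∑ μ, ∑ ν, v μ * v ν * P μ ν z) * (∑ i, k i * z i) ^ 2
      = (∑ μ, ∑ α, if α = μ then 0 else B12Beta.secondMoment P α μ * v μ ^ 2 * k α ^ 2)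
        - ∑ μ, ∑ ν, if μ = ν then 0 else B12Beta.secondMoment P μ ν * v μ * v ν * k μ * k ν := by
  rw [tsum_form_sq_phase_eq hP]
  simp_rw [contract_row hP hT hS hR k]
  have e : ∀ μ, ∑ ν, v μ * v ν * (if μ = ν then ∑ α, (if α = μ then 0 else -2 * B12Beta.secondMoment P α μ * k α ^ 2) else 2 * k μ * k ν * B12Beta.secondMoment P μ ν)
      = -2 * (∑ α, if α = μ then 0 else B12Beta.secondMoment P α μ * v μ ^ 2 * k α ^ 2) + 2 * ∑ ν, if μ = ν then 0 else B12Beta.secondMoment P μ ν * v μ * v ν * k μ * k ν := by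
    intro μ
    have hsplit : ∀ ν, v μ * v ν * (if μ = ν then ∑ α, (if α = μ then 0 else -2 * B12Beta.secondMoment P α μ * k α ^ 2) else 2 * k μ * k ν * B12Beta.secondMoment P μ ν)
        = (if μ = ν then v μ ^ 2 * ∑ α, (if α = μ then 0 else -2 * B12Beta.secondMoment P α μ * k α ^ 2) else 0)
          + 2 * (if μ = ν then 0 else B12Beta.secondMoment P μ ν * v μ * v ν * k μ * k ν) := by
      intro ν
      split_ifs with h
      · subst h; ring
      · ring
    rw [Finset.sum_congr rfl fun ν _ => hsplit ν, Finset.sum_add_distrib, Finset.sum_ite_eq]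
    simp only [Finset.mem_univ, if_true]
    rw [← Finset.mul_sum]
    congr 1
    rw [Finset.mul_sum, Finset.mul_sum]
    refine Finset.sum_congr rfl fun α _ => ?_
    split_ifs <;> ring
  rw [Finset.sum_congr rfl fun μ _ => e μ, Finset.sum_add_distrib, ← Finset.mul_sum, ← Finset.mul_sum]
  ring

/-- [folklore] **… = THE β-WEIGHTED PLÜCKER FORM** `½ Σ_μ Σ_ν [μ ≠ ν] β_{μν} (v_μ k_ν − v_ν k_μ)²` ((5.8): `β_{μν} = β_{νμ}`). -/
theorem germ_eq_pluecker {P : B12Beta.Kernel d} (hP : MomentSummable P 3) (hT : WardTransversal P) (hS : IndexSymmetric P) (hR : AxisReflectionCovariant P) (v k : Fin d → ℝ) :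
    -(1 / 2) * ∑' z, (∑ μ, ∑ ν, v μ * v ν * P μ ν z) * (∑ i, k i * z i) ^ 2
      = (1 / 2) * ∑ μ, ∑ ν, if μ = ν then 0 else B12Beta.secondMoment P μ ν * (v μ * k ν - v ν * k μ) ^ 2 := by
  rw [germ_closedForm hP hT hS hR]
  -- symmetrise the first double sum using β_{αμ} = β_{μα}
  have h1 : (∑ μ, ∑ α, if α = μ then 0 else B12Beta.secondMoment P α μ * v μ ^ 2 * k α ^ 2) = ∑ μ, ∑ ν, if μ = ν then 0 else B12Beta.secondMoment P μ ν * v μ ^ 2 * k ν ^ 2 := by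
    refine Finset.sum_congr rfl fun μ _ => Finset.sum_congr rfl fun α _ => ?_
    by_cases h : α = μ
    · subst h; simp
    · rw [if_neg h, if_neg (Ne.symm h), secondMoment_comm hS α μ]
  have h2 : (∑ μ, ∑ ν, if μ = ν then 0 else B12Beta.secondMoment P μ ν * v μ ^ 2 * k ν ^ 2) = ∑ μ, ∑ ν, if μ = ν then 0 else B12Beta.secondMoment P μ ν * v ν ^ 2 * k μ ^ 2 := by
    rw [Finset.sum_comm]
    refine Finset.sum_congr rfl fun μ _ => Finset.sum_congr rfl fun ν _ => ?_
    by_cases h : ν = μ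
    · subst h; simp
    · rw [if_neg h, if_neg (Ne.symm h), secondMoment_comm hS ν μ]
  have h3 : (∑ μ, ∑ α, if α = μ then 0 else B12Beta.secondMoment P α μ * v μ ^ 2 * k α ^ 2)
      = (1 / 2) * ((∑ μ, ∑ ν, if μ = ν then 0 else B12Beta.secondMoment P μ ν * v μ ^ 2 * k ν ^ 2) + ∑ μ, ∑ ν, if μ = ν then 0 else B12Beta.secondMoment P μ ν * v ν ^ 2 * k μ ^ 2) := by
    rw [← h2, h1]; ring
  have h4 : (∑ μ, ∑ ν, if μ = ν then 0 else B12Beta.secondMoment P μ ν * (v μ * k ν - v ν * k μ) ^ 2)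
      = (∑ μ, ∑ ν, if μ = ν then 0 else B12Beta.secondMoment P μ ν * v μ ^ 2 * k ν ^ 2) + (∑ μ, ∑ ν, if μ = ν then 0 else B12Beta.secondMoment P μ ν * v ν ^ 2 * k μ ^ 2)
        - 2 * ∑ μ, ∑ ν, if μ = ν then 0 else B12Beta.secondMoment P μ ν * v μ * v ν * k μ * k ν := by
    have hpt : ∀ μ ν, (if μ = ν then (0 : ℝ) else B12Beta.secondMoment P μ ν * (v μ * k ν - v ν * k μ) ^ 2)
        = (if μ = ν then 0 else B12Beta.secondMoment P μ ν * v μ ^ 2 * k ν ^ 2) + (if μ = ν then 0 else B12Beta.secondMoment P μ ν * v ν ^ 2 * k μ ^ 2)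
          - 2 * (if μ = ν then 0 else B12Beta.secondMoment P μ ν * v μ * v ν * k μ * k ν) := by
      intro μ ν; split_ifs <;> ring
    simp_rw [hpt, Finset.sum_sub_distrib, Finset.sum_add_distrib, ← Finset.mul_sum]
  rw [h3, h4]; ring

/-! ## §3 Sign: the germ is nonnegative for all `(v, k)` IFF all six (1.22) coefficients are `≥ 0` -/

/-- [folklore] Basis evaluation of the form: `Σ_{μν} e_b(μ) e_b(ν) P_{μν}(z) = P_{bb}(z)` and `e_a·z = z_a`. -/
theorem form_basis (P : B12Beta.Kernel d) (b : Fin d) (z : Fin d → ℤ) :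
    (∑ μ, ∑ ν, (if μ = b then (1 : ℝ) else 0) * (if ν = b then (1 : ℝ) else 0) * P μ ν z) = P b b z := by
  rw [Finset.sum_eq_single b (fun μ _ hμ => by simp [hμ]) (fun h => absurd (Finset.mem_univ b) h)]
  rw [Finset.sum_eq_single b (fun ν _ hν => by simp [hν]) (fun h => absurd (Finset.mem_univ b) h)]
  simp

/-- [folklore] `e_a · z = z_a`. -/
theorem phase_basis (a : Fin d) (z : Fin d → ℤ) : (∑ i, (if i = a then (1 : ℝ) else 0) * (z i : ℝ)) = (z a : ℝ) := by
  rw [Finset.sum_eq_single a (fun i _ hi => by simp [hi]) (fun h => absurd (Finset.mem_univ a) h)]; simp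

/-- [folklore] **AT THE BASIS PAIR `(v, k) = (e_b, e_a)` THE GERM IS `β_{ab}`** (`a ≠ b`; this is row 95's diagonal ∕ axis germ `−½ Σ_z P_{bb}(z) z_a² = β_{ab}`, row 86). -/
theorem germ_basis {P : B12Beta.Kernel d} (hP : MomentSummable P 3) (hT : WardTransversal P) (hS : IndexSymmetric P) {a b : Fin d} (hab : a ≠ b) :
    -(1 / 2) * ∑' z, (∑ μ, ∑ ν, (if μ = b then (1 : ℝ) else 0) * (if ν = b then (1 : ℝ) else 0) * P μ ν z) * (∑ i, (if i = a then (1 : ℝ) else 0) * (z i : ℝ)) ^ 2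
      = B12Beta.secondMoment P a b := by
  simp_rw [form_basis, phase_basis]
  rw [secondMoment_eq_neg_half_of_ward_indexSymmetric hP hT hS hab]

/-- [folklore] **THE GERM IS `≥ 0` AT EVERY `(v, k)` IFF EVERY OFF-DIAGONAL (1.22) COEFFICIENT IS `≥ 0`** (under (5.7)–(5.9) + summable third moments): «⟸» the Plücker form is a nonnegative
combination of squares; «⟹» evaluate at `(e_b, e_a)`.  So, to second order at zero momentum, positive semi-definiteness of the polarization symbol on real vectors IS the statement
`∀ a ≠ b, 0 ≤ β_{ab}` — neither more nor less. -/
theorem germ_nonneg_iff {P : B12Beta.Kernel d} (hP : MomentSummable P 3) (hT : WardTransversal P) (hS : IndexSymmetric P) (hR : AxisReflectionCovariant P) :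
    (∀ v k : Fin d → ℝ, 0 ≤ -(1 / 2) * ∑' z, (∑ μ, ∑ ν, v μ * v ν * P μ ν z) * (∑ i, k i * z i) ^ 2) ↔ ∀ a b : Fin d, a ≠ b → 0 ≤ B12Beta.secondMoment P a b := by
  constructor
  · intro h a b hab
    rw [← germ_basis hP hT hS hab]
    exact h _ _
  · intro h v k
    rw [germ_eq_pluecker hP hT hS hR]
    refine mul_nonneg (by norm_num) (Finset.sum_nonneg fun μ _ => Finset.sum_nonneg fun ν _ => ?_)
    split_ifs with hμν
    · exact le_rfl
    · exact mul_nonneg (h μ ν hμν) (sq_nonneg _)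

end Summit.QuantumFields.BalabanUV.Gaps.D1ReflectionSecondMoments
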